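import Summits.ResolutionOfSingularities.ResolutionOfSingularities.Theorems.EquisingularLiftEquisingularLiftNatSubchainPointResolutionOff
import Summits.ResolutionOfSingularities.ResolutionOfSingularities.Theorems.EquisingularLiftEquisingularLiftNatNDInvPersists
import Summits.ResolutionOfSingularities.ResolutionOfSingularities.Theorems.EquisingularLiftEquisingularLiftNatNDSNCInv2
import Summits.ResolutionOfSingularities.ResolutionOfSingularities.Theorems.EquisingularLiftEquisingularLiftNatNDRoundModel
import Summits.ResolutionOfSingularities.ResolutionOfSingularities.Theorems.EquisingularLiftEquisingularLiftNatNDRoundModelSplit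
import Summits.ResolutionOfSingularities.ResolutionOfSingularities.Theorems.EquisingularLiftEquisingularLiftNatNDModelStep
import Summits.ResolutionOfSingularities.ResolutionOfSingularities.Theorems.EquisingularLiftEquisingularLiftNatNDTransportEnd
import Summits.ResolutionOfSingularities.ResolutionOfSingularities.Theorems.EquisingularLiftEquisingularLiftNatNDPlayFacts
import Summits.ResolutionOfSingularities.ResolutionOfSingularities.Theorems.EquisingularLiftEquisingularLiftNatNDInvInit
import Summits.ResolutionOfSingularities.ResolutionOfSingularities.Theorems.EquisingularLiftEquisingularLiftNatNDTransportStep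
import Summits.ResolutionOfSingularities.ResolutionOfSingularities.Theorems.EquisingularLiftEquisingularLiftNatNDTransportInit
import Summits.ResolutionOfSingularities.ResolutionOfSingularities.Theorems.EquisingularLiftEquisingularLiftNatNDModelRoundEnd
import Summits.ResolutionOfSingularities.ResolutionOfSingularities.Theorems.EquisingularLiftEquisingularLiftNatNDModelInit
import Summits.ResolutionOfSingularities.ResolutionOfSingularities.Theorems.EquisingularLiftEquisingularLiftNatNDStratumFacts
import Summits.ResolutionOfSingularities.ResolutionOfSingularities.Theorems.EquisingularLiftEquisingularLiftNatSNCInvStepFacts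
import Summits.ResolutionOfSingularities.ResolutionOfSingularities.Theorems.EquisingularLiftEquisingularLiftNatNDSncInvInit
import Summits.ResolutionOfSingularities.ResolutionOfSingularities.Theorems.EquisingularLiftEquisingularLiftNatResidueHypDefs
import Summits.ResolutionOfSingularities.ResolutionOfSingularities.Theorems.EquisingularLiftEquisingularLiftNatNDChartPlays
import Summits.ResolutionOfSingularities.ResolutionOfSingularities.Theorems.FrobeniusClosingPatchingRelPerfectDepthSNCPointwise
import Literature.AlgebraicGeometry.Resolution.MarkedIdeals
import HarnessLib

/-!
# `toric-towers` — ROUND 9/10 (g23), v7 (= the desk's «SPEC v6»: RE-HOMED on the tree's `…NatNDStrataTower` p638808 + `SNCInv₂` MERGED RE-CUT of record 14:06:05Z) · §13 THE K5-NATIVE SPEC («ND ENGINE WORD») of the local ND rung: `nd_rung_local` = ONE application of the tree's K5′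
# `target_elnat_of_subchainResolution'` at `Reach := ReachToric n`, modulo TWO typed bricks (B3) `hsub_strataLift` (O-side) and (B4) `hres_toricRounds` (k-side)

[OURS · L1 W4.5(b) · counted 0 · AI-written, weaker than expert review; nothing of [Hironaka2017] is asserted; NOT a statement of the manuscript.]
VERSION v14 (g23; port p643982 ✓; ALL EIGHT bricks ✓ imported — k-side census 8/8 (desk BOOK 16:02:13Z): p645490 `ndInv_init` · p644429 `playFacts` · p644838 `modelInit` · p646530 `modelStep` · p644394 `modelEnd` · p644379 `transportInit` · p644680 `transportStep` · p646559 `transportEnd`; SORRIES 0 — the whole chain `hsub_strataLift` / `modelRound` / `transportRoundLN` / `roundAtNDFrameLN` / `ndInvLN_round` / `hres_toricRounds` / `nd_rung_local_K5` / `ndStubWonK5_holds` is sorry-free here; the TREE home is lead-2 g7's closing module, the 35th): v9 = re-home on p640760/p641032/p641231 + §13.14 (B4α) sub-split · v10 = (B3g) p641592 / (B3b) p641843 imported + (TS0) + §13.15 (B4β) sub-split ·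
v10.1 = junk-`A` guard `(∃ Φ, ToricStage n k g Φ A φA EA TA) →` in `TransportEnd` (port draft v3 78b2624375340a7a) ·
v11 = (B3a) p642183 imported + the LN CASCADE (desk RULING 14:52:12Z on stub-2's objection): §13.13′ `NDInvCLN`/`RoundAtNDFrameLN`/`TransportRoundLN` chain re-derived,
§13.15 `IsLocallyNoetherian` on `F₁` and in `FStage` (port draft v4) ·
v12 = RE-HOMED on lead-2's port `Theorems/…NatNDRoundModelSplit.lean` (= draft v4 2fd04eaad88dd372): §13.13′/§13.14/§13.15 declarations imported, only the
EIGHT k-side brick signatures (sorried: `ndInv_init` (B4γ) · `playFacts` (B4α0) · `modelInit` (B4α1i) · `modelStep` (B4α1s) · `modelEnd` (B4α2) ·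
`transportInit` (B4β0) · `transportStep` (B4β1) · `transportEnd` (B4β2)) + the derivations remain here; each brick lands BY NAME as a Theorems file importing the port.
Desk R31 input (β) (STATUS 2026-08-28T13:20:47Z): «the chain's first BY-NAME closure target = the registered ND stub
`stub_elnat_three_isolated_newtonNondegenerate` … needs `nd_rung_local`'s O-side ONLY … idea-1 g23 as spec author ((B3)/(B4)/(B5) signatures), lead-2 as text
owner/closer, owners from {stub-2, stub-4, 027}».  THIS FILE IS THAT SPEC.  It is a NEW workfile because `NewtonNondegenerateRung.lean` (NNR v13, 198 918 B) is at
the 200 000-byte `crux write` limit and Cruxes modules cannot import one another on the farm; §13.4 therefore RESTATES `nd_rung_local`'s type verbatim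
(`nd_rung_local_K5`) and the registered child's type verbatim (`NDStubWonK5`, character-identical to NNR §10.3 `NDStubWon`) and proves both from (B3)+(B4).

## The architecture (why no (B5) is left to write)

The tree ALREADY owns the whole `O`-side ENGINE of a «point, then admissible sub-chain» resolution: K5′ =
`…Cruxes.EquisingularLiftNat.Sections.target_elnat_of_subchainResolution'` (`Theorems/…NatSubchainPointResolutionOff.lean`; any `n`; PARAMETRIC in the downstairs
admissibility predicate `Reach`).  It contains (B5) of the card (the ambient `ℙⁿ_O` over `O := W(k)` via `stub_wittRing`, the base model square, the horizontal
induction predicate `Ch`, the SECTION through a singular point inside a smooth neighbourhood (T-DIM), its blow-up, the model squares `modelStep`/`modelStep_chain`,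
the iteration over SEVERAL singular points through the downstairs closure operator `Q`, and the final `EquisingularLiftNat`-shaped conclusion `ELNatConclusionO`).
What K5′ asks of a customer is exactly two things, and for the ND line they are:

* **(B4) `hres_toricRounds`** (k-side, scheme level): from `IsoHypNDWon k n H ι` + `hfin`, a downstairs resolution of `range ι ⊂ ℙⁿ_k` by ROUNDS «blow up a
  non-regular closed point `x` of the reduced strict transform (ambient regular at `x`); then run the `ReachToric`-admissible sub-chain» ending with a regular
  reduced total strict transform.  `ReachToric` (§13.1) = «a FRAME `W` at `x` (n divisors through `x` whose stalk generators are a regular system of parameters)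
  and a STRATA TOWER: successive blow-ups of the strata `τ.sup E` of the evolving boundary `E` (exceptional divisors + strict transforms, indexed by RAYS), each
  blown-up face `τ` having a NON-FRAME ray (so its stratum lies over `x`), each step E1-LEGAL (`supp (τ.sup E) ⊆ T`, `¬ T ⊆ supp`)».  The k-side prover feeds it
  the WON PLAY of `LocalNDWon`: legality = `Bad` = E1 (`…ND.e1_along_play`, `bad_iff_toricStrict_vanishes`), non-frame ray = `not_bad_coordinateFace`, END =
  `…ND.end_order_one_of_wonPlay` / `end_of_wonPlay` (Khovanskii–Ishii in Jacobian form) transported along the étale frame chart.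
* **(B3) `hsub_strataLift`** (O-side) = K5′'s HSUB(ReachToric): after K5′'s point step (section `s`, `τ₁ = Bl_{ker s}`, model square `j₂`, carrier identity
  `(ker s)·𝒪 ∣_{F₂} = 𝔪_x·𝒪_{F₂}`), EVERY strata tower downstairs is matched by a `Ch`-stage with a model square.  It is EQUATION-FREE and FAN-FREE: lift the
  frame (`G_j ∈ ker s♯` lifting `w_j`, `(ϖ, G_1, …, G_n)` an r.s.p. at `s(𝔪)` by T-DIM — companion §12.11/12.12 `exists_coeffLift_parameters`,
  `exists_parameters_atSection`), carry the UPSTAIRS boundary `Ẽ` (special fibre `F` :: frame lifts :: exceptionals; SNC near the section by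
  `Literature…HasSNCWith.hasSNC_transform`), and at each face `τ` call `modelStep_chain` with the upstairs stratum `τ.sup Ẽ`: REGULAR
  (`isRegular_subscheme_finsetSup`), `O`-FLAT (transversal to `F`: `ϖ` is a parameter off the stratum's generators ⇒ torsion-free over the DVR; companion §12.17
  `flat_specMap_quot_span_X` is the chart form), `comap j = τ.sup E` (`comap_finsetSup` + the carrier identity for exceptional rays + `StrictTransformBaseChange`
  for strict transforms; equality of STALKS near the fibre over `x` suffices because `τ` has a non-frame ray), off-generic (`off_generic_of_subset_preimage` with
  `A := supp (ker s)` and K5′'s hypothesis `∀ c ∈ supp (ker s), ¬ IsGenericPoint (σ' c) Y`).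
* **(B5)** := K5′ (tree).  §13.4 `nd_rung_local_K5` is the 1-line application — PROVED here.

## Contents
* §13.1 `Boundary`, `stratum`, `Boundary.stepAlong`, `frameBoundary`, `IsFrameAt`, `StrataTower` (inductive), **`ReachToric`** — pure definitions over tree
  notions (`Scheme.IdealSheafData`, `Literature…strictTransformIdeal`, `…stalkIdeal`, `…Sections.e`/`Ray`).
* §13.2/§13.7 (B3) `hsub_strataLift` — SIGNATURE = K5′'s HSUB block VERBATIM with `Reach := ReachToric n`; DERIVED (§13.7) from the three clause-bricks
  (B3a) `sncInv_init`, (B3g) `sncInv_stratumFacts`, (B3b) `sncInv_stepFacts` of the CANDIDATE invariant `SNCInv₂` through the PROVED iteration §13.6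
  `strataTower_lift` / `hsub_of_invariant` / `hsub_strataLift_of_invariant` (parametric in the invariant `G`; owners stub-2 / stub-4 / 027 per desk may swap `G`).
* §13.3 (B4) `hres_toricRounds` — SIGNATURE (= K5′'s `hres` block VERBATIM with `Reach := ReachToric n`, under `nd_rung_local`'s hypotheses); `sorry`.
* §13.8 `nd_rung_local_K5` (the type of NNR §10.3 `nd_rung_local`, VERBATIM) and `NDStubWonK5`/`ndStubWonK5_holds` (the registered child's type) — PROVED from
  (B3)+(B4) by K5′.
* §13.6 (B3c) the iteration PROVED; §13.7 the candidate invariant `SNCInv₂` and its three clause-bricks (sorried signatures).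
* §13.9 (B4δ) the k-side iteration PROVED: `RoundClosed` (K5′'s closure condition verbatim), `RoundFacts`, `rounds_resolve`, `hres_of_rounds` — `hres`(ReachToric)
  from ANY downstairs invariant `DI m` with init / end / round clauses (strong induction on the measure through the closure operator `Q`); so (B4) = «exhibit `DI`»
  (candidate and its clauses (B4α–γ) = ROUND 10).
* §13.12 (v5, desk DEAL «ND-K5» (β): «idea-1 types the split (B4α)–(B4δ) as sorried sub-signatures with the composition PROVED») `RoundAtNDFrame` (B4α′),
  `NDInvPersists` (B4β′), the closed variant `NDInvC`, `ndInv_round_of` PROVED, `ndInv_round` DERIVED; `hres_toricRounds` runs §13.9 on `NDInvC`.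
* §13.10 (v4) the candidate downstairs invariant `NDInv` (`baseToStalk`, `IsNDFrameAt` — GERM-level local ND frame data —, `NDInv`), (B4-end) `ndInv_end` PROVED,
  (B4-init) `ndInv_init` / (B4-round) `ndInv_round` sorried signatures; §13.11 (B4) `hres_toricRounds` DERIVED via `hres_of_rounds`; §13.8 moved last.
* §13.5 small certified facts about the definitions (`stratum` of a face with an absent ray is `⊤`-insensitive; `1 = Σ e_j`; the frame boundary's values).

v7 (= desk «SPEC v6», rulings 14:00:08Z/14:04:42Z/14:06:05Z): imports `…Theorems.EquisingularLiftEquisingularLiftNatNDStrataTower` (p638808) and DROPS the ported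
§13.1/§13.5/§13.6(`StageTuple`…`strataTower_lift`)/§13.9; keeps `hsub_of_invariant`/`hsub_strataLift_of_invariant` (not in p638808); §13.7 `SNCInv₂` := the MERGED
RE-CUT (027 U-free pointwise (b)(c) via `Theorems.DepthSNC.SNCWithAt` + stub-2 (A1) `IsClosedImmersion jm` + (A2) pointwise stalk guard (c′)); (B3g)/(B3b) binders
`(O) (k) (θ) (hθ : Function.Surjective θ) (P) (q) (Y) (Ch) (n)` (S-T36; stub-4 RE-CUT); S-T37 `base_closed` → `Scheme.Hom.isClosedEmbedding` in `hres_toricRounds`.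
Sorries (v7): EXACTLY 6, ALL CLAUSE-LEVEL — O-side (B3a) `sncInv_init`, (B3g) `sncInv_stratumFacts`, (B3b) `sncInv_stepFacts`; k-side (B4-init = B4γ) `ndInv_init`,
(B4α′) `roundAtNDFrame` (toric heart + étale transport), (B4β′) `ndInvPersists` (bookkeeping); (B4-round) `ndInv_round` and (B4δ) are DERIVED/PROVED.  (B3) `hsub_strataLift`, (B4) `hres_toricRounds`, the rung `nd_rung_local_K5` and the child `ndStubWonK5_holds` are DERIVED.  Standard axioms elsewhere
(`hsub_strataLift_of_invariant`, `strataTower_lift`, `hsub_of_invariant`: propext / Classical.choice / Quot.sound).  No `def` of the tree is duplicated; when the text owner ports §13.1 to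
`Theorems/`, the names can be kept (namespace `…Sections.ND`).
-/

set_option linter.dupNamespace false
set_option linter.overlappingInstances false
noncomputable section
open CategoryTheory CategoryTheory.Limits AlgebraicGeometry TopologicalSpace Topology
open MvPolynomial
open Literature.AlgebraicGeometry.Resolution
open AlgebraicGeometry.Scheme.IdealSheafData

namespace Summit.ResolutionOfSingularities.ResolutionOfSingularities.Cruxes.EquisingularLiftNat.Sections.ND

variable {n : ℕ}

-- §13.1 (definitions), §13.5 (small print), §13.6 `StageTuple`/`StratumFacts`/`StepFacts`/`strataTower_lift` and §13.9 (`RoundClosed`/`RoundFacts`/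
-- `rounds_resolve`/`hres_of_rounds`) are TREE DECLARATIONS since p638808 (`Theorems/…NatNDStrataTower.lean`, lead-2 (D)); this spec imports them (v6 re-home).

/-! ## 13.2 (B3) THE O-SIDE BRICK — `hsub_strataLift` = HSUB(ReachToric): frame-strata sub-chains lift (signature; owners per desk R31) -/

/-! (B3) `hsub_strataLift` — K5′'s sub-chain supplier HSUB at `Reach := ReachToric n`, VERBATIM — is stated and DERIVED in §13.7 (after the iteration §13.6
and the candidate invariant), from the three clause-bricks (B3a) `sncInv_init`, (B3g) `sncInv_stratumFacts`, (B3b) `sncInv_stepFacts`. -/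

/-! ## 13.3 (B4) THE k-SIDE BRICK — `hres_toricRounds`: isolated `LocalNDWon` points are resolved by «point ; won strata tower» rounds (signature) -/

-- (B4) `hres_toricRounds`: see §13.11 below (DERIVED from the downstairs invariant `NDInv` via §13.9 `hres_of_rounds`).


-- (B3c) `hsub_of_invariant` / `hsub_strataLift_of_invariant` are TREE DECLARATIONS since p639684 (`Theorems/…NatNDInvariants.lean`, lead-2); imported (v8 re-home).

/-! ## 13.7 (B3a)/(B3g)/(B3b) — the CANDIDATE invariant `SNCInv₂` (idea-1's proposal; the O-side owners may refine it, `hsub_strataLift_of_invariant` accepts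
any `G`), its three clauses as the bricks to prove, and (B3) `hsub_strataLift` DERIVED from them -/

-- `SNCInv₂` (§13.7 text of record, desk MERGE 2026-08-28T14:06:05Z) is a TREE DECLARATION since p641032 (`Theorems/…NatNDSNCInv2.lean`, lead-2, = draft
-- 30cac69141cfd62a VERBATIM); imported (v9 re-home). Its docstring there carries the clause-by-clause reading ((A1)(a)(b)(c)(c′)(d)).

-- (B3a) `sncInv_init (k) [Field k] (n) : …` is a TREE THEOREM since p642183 (`Theorems/…NatNDSncInvInit.lean`, 027 g19) BY TYPE of the v8 §13.7 signature; imported (v11),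
-- used BY NAME in `hsub_strataLift` below.

-- (B3g) `sncInv_stratumFacts` is a TREE THEOREM since p641592 (`Theorems/…NatNDStratumFacts.lean`, stub-4 g11) and (B3b) `sncInv_stepFacts` since p641843
-- (`Theorems/…NatSNCInvStepFacts.lean`, stub-2 g14) — both BY TYPE of the v8 §13.7 signatures, binder order `(O) (k) (θ) (hθ) (P) (q) (Y) (Ch) (n)`; imported (v10), used BY NAME below.

/-- **(B3) `hsub_strataLift` DERIVED** from the candidate invariant's three clauses (B3a) `sncInv_init`, (B3g) `sncInv_stratumFacts`, (B3b) `sncInv_stepFacts`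
through the PROVED iteration `hsub_strataLift_of_invariant`.  [OURS · L1 W4.5b · pure logic; its `sorry`s are the three clauses'] -/
theorem hsub_strataLift (k : Type) [Field k] (n : ℕ) :
    (∀ (O : Type) [CommRing O] [IsDomain O] [IsDiscreteValuationRing O] [IsAdicComplete (IsLocalRing.maximalIdeal O) O]
        [IsAlgClosed (IsLocalRing.ResidueField O)] (θ : O →+* k), Function.Surjective θ →
      ∀ (P : AlgebraicGeometry.Scheme.{0}) (q : P ⟶ AlgebraicGeometry.Spec (.of O)) (Y : Set P)
        (Ch : ∀ X' : AlgebraicGeometry.Scheme.{0}, (X' ⟶ P) → Set X' → Prop),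
        (∀ (X' X'' : AlgebraicGeometry.Scheme.{0}) (σ' : X' ⟶ P) (S' : Set X') (C : X'.IdealSheafData) (τ : X'' ⟶ X'),
          Ch X' σ' S' → Literature.AlgebraicGeometry.Resolution.IsBlowup τ C →
          Literature.AlgebraicGeometry.Resolution.Scheme.IsRegular C.subscheme → AlgebraicGeometry.Flat (C.subschemeι ≫ σ' ≫ q) →
          σ' '' (C.support : Set X') ⊆ {y | ¬ IsGenericPoint y Y} →
          (C.support : Set X') ∩ (σ' ≫ q) ⁻¹' {IsLocalRing.closedPoint O} ⊆ S' →
          Ch X'' (τ ≫ σ') (closure (τ ⁻¹' (S' \ (C.support : Set X'))))) →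
        (∀ (X' : AlgebraicGeometry.Scheme.{0}) (σ' : X' ⟶ P) (S' : Set X'), Ch X' σ' S' →
          Summit.ResolutionOfSingularities.ResolutionOfSingularities.Theses.EquisingularLift.Split.Chain P Y X' σ' S') →
        Y ⊆ q ⁻¹' {IsLocalRing.closedPoint O} → IsIrreducible Y → IsClosed Y →
        AlgebraicGeometry.IsIntegral P → IsLocallyNoetherian P → Literature.AlgebraicGeometry.Resolution.Scheme.IsRegular P →
        AlgebraicGeometry.IsProper q → AlgebraicGeometry.SmoothOfRelativeDimension n q →
      -- the stage before the point step and its model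
      ∀ (X' : AlgebraicGeometry.Scheme.{0}) (σ' : X' ⟶ P) (S' : Set X'), Ch X' σ' S' → AlgebraicGeometry.IsIntegral X' →
        IsLocallyNoetherian X' → Literature.AlgebraicGeometry.Resolution.Scheme.IsRegular X' →
        AlgebraicGeometry.IsDominant (σ' ≫ q) →
      ∀ (F₁ : AlgebraicGeometry.Scheme.{0}), AlgebraicGeometry.IsIntegral F₁ → ∀ (j : F₁ ⟶ X')
        (t : F₁ ⟶ AlgebraicGeometry.Spec (.of k)),
        IsPullback j t (σ' ≫ q) (AlgebraicGeometry.Spec.map (CommRingCat.ofHom θ)) →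
      ∀ (T₁ : Set F₁), IsClosed T₁ → IsIrreducible T₁ → j '' T₁ = S' →
      -- the point step: section, its blow-up, the new stage and its model
      ∀ (x : F₁) (hx : IsClosed ({x} : Set F₁)) (U : X'.Opens), AlgebraicGeometry.Smooth (U.ι ≫ σ' ≫ q) →
      ∀ (s : AlgebraicGeometry.Spec (.of O) ⟶ X'), s ≫ σ' ≫ q = 𝟙 _ → s (IsLocalRing.closedPoint O) ∈ U →
        s (IsLocalRing.closedPoint O) = j x →
        ringKrullDim (X'.presheaf.stalk (s (IsLocalRing.closedPoint O))) = ((n + 1 : ℕ) : WithBot ℕ∞) →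
        IsRegularLocalRing (F₁.presheaf.stalk x) →
        (∀ c ∈ (s.ker.support : Set X'), ¬ IsGenericPoint (σ' c) Y) →
      ∀ (X₁ : AlgebraicGeometry.Scheme.{0}) (τ₁ : X₁ ⟶ X'), Literature.AlgebraicGeometry.Resolution.IsBlowup τ₁ s.ker →
        AlgebraicGeometry.IsIntegral X₁ → IsLocallyNoetherian X₁ → Literature.AlgebraicGeometry.Resolution.Scheme.IsRegular X₁ →
        AlgebraicGeometry.IsDominant ((τ₁ ≫ σ') ≫ q) →
      ∀ (F₂ : AlgebraicGeometry.Scheme.{0}), AlgebraicGeometry.IsIntegral F₂ → ∀ (υ : F₂ ⟶ F₁),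
        Literature.AlgebraicGeometry.Resolution.IsBlowup υ
          (AlgebraicGeometry.Scheme.IdealSheafData.vanishingIdeal (⟨{x}, hx⟩ : TopologicalSpace.Closeds F₁)) →
      ∀ (j₂ : F₂ ⟶ X₁) (t₂ : F₂ ⟶ AlgebraicGeometry.Spec (.of k)),
        IsPullback j₂ t₂ ((τ₁ ≫ σ') ≫ q) (AlgebraicGeometry.Spec.map (CommRingCat.ofHom θ)) → j₂ ≫ τ₁ = υ ≫ j →
        (s.ker.comap τ₁).comap j₂ =
          (AlgebraicGeometry.Scheme.IdealSheafData.vanishingIdeal (⟨{x}, hx⟩ : TopologicalSpace.Closeds F₁)).comap υ →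
        IsIrreducible (closure (υ ⁻¹' (T₁ \ {x}))) →
        Ch X₁ (τ₁ ≫ σ') (j₂ '' closure (υ ⁻¹' (T₁ \ {x}))) →
      -- the admissible downstairs sub-chains are matched upstairs
      ∀ (F₉ : AlgebraicGeometry.Scheme.{0}) (β : F₉ ⟶ F₂) (T₉ : Set F₉), ReachToric n F₁ F₂ υ x (closure (υ ⁻¹' (T₁ \ {x}))) F₉ β T₉ →
        ∃ (X₉ : AlgebraicGeometry.Scheme.{0}) (σ₉ : X₉ ⟶ P) (S₉ : Set X₉) (j₉ : F₉ ⟶ X₉)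
          (t₉ : F₉ ⟶ AlgebraicGeometry.Spec (.of k)),
          Ch X₉ σ₉ S₉ ∧ AlgebraicGeometry.IsIntegral X₉ ∧ IsLocallyNoetherian X₉ ∧
          Literature.AlgebraicGeometry.Resolution.Scheme.IsRegular X₉ ∧ AlgebraicGeometry.IsDominant (σ₉ ≫ q) ∧
          IsPullback j₉ t₉ (σ₉ ≫ q) (AlgebraicGeometry.Spec.map (CommRingCat.ofHom θ)) ∧ j₉ '' T₉ = S₉ ∧
          IsClosed T₉ ∧ IsIrreducible T₉ ∧ AlgebraicGeometry.IsIntegral F₉) := by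
  refine hsub_strataLift_of_invariant k n ?_
  intro O _ _ _ _ _ θ hθ P q Y Ch hStep hChain hYq hYirr hYcl hPint hPn hPreg hqpr hqsm X' σ' S' hCh hX'i hX'n hX'r hdom F₁ hF₁ j t hsq
    T₁ hT₁cl hT₁irr hjT x hx U hU s hs hsU hsx hdim hregx hoffs X₁ τ₁ hτ₁ hX₁i hX₁n hX₁r hX₁dom F₂ hF₂ υ hυ j₂ t₂ hsq₂ hcomm hcarr
    hT₂irr hCh₁
  exact ⟨SNCInv₂ (n := n) P Y,
    sncInv_init k n O θ hθ P q Y Ch hStep hChain hYq hYirr hYcl hPint hPn hPreg hqpr hqsm X' σ' S' hCh hX'i hX'n hX'r hdom F₁ hF₁ j t hsq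
      T₁ hT₁cl hT₁irr hjT x hx U hU s hs hsU hsx hdim hregx hoffs X₁ τ₁ hτ₁ hX₁i hX₁n hX₁r hX₁dom F₂ hF₂ υ hυ j₂ t₂ hsq₂ hcomm hcarr
      hT₂irr hCh₁,
    sncInv_stratumFacts O k θ hθ P q Y Ch n, sncInv_stepFacts O k θ hθ P q Y Ch n⟩

/-! ## 13.10 (B4, ROUND 10 preview) THE CANDIDATE DOWNSTAIRS INVARIANT `NDInv` and its clauses (B4-init) / (B4-end, PROVED) / (B4-round)

`NDInv m F ρ T`: the ambient floor `F` is regular, and the reduced closure `T̂` of `T` has EXACTLY the finite set `S` (`|S| = m`) of non-regular points, each a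
closed point carrying LOCAL ND FRAME DATA (`IsNDFrameAt`): a frame `W` with stalk generators `w₁,…,wₙ` (an r.s.p. of `𝒪_{F,x}`, `dim = n`) and a polynomial
`g ∈ LocalNDWon` (tree `…Sections.LocalNDWon`: convenient + locally Newton-nondegenerate + a WON E1-legal play) with `(𝓘_T̂)_x = (g(w))`, coefficients through the
structure map `k → 𝒪_{F,x}` of the `ℙⁿ_k`-scheme `F` (`baseToStalk`).  GERM-level like `IsFrameAt` (the étale chart `V → 𝔸ⁿ_k`, `t ↦ w`, is DERIVED by the provers:
`Literature.AlgebraicGeometry.Resolution.localRingHom_flat_and_formallyUnramified` is the field-case template).  The k-side owner may strengthen `NDInv`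
(e.g. add `IsIntegral F`, `IsLocallyNoetherian F`) without touching §13.9. -/

section NDInvariant

variable (n : ℕ) (k : Type) [Field k]

-- `baseToStalk`, `IsNDFrameAt`, `isFrameAt_of_isNDFrameAt`, `NDInv`, `ndInv_end` are TREE DECLARATIONS since p639684 (`…NatNDInvariants.lean`); imported (v8).

-- `ndInv_init` is a TREE THEOREM since `Theorems/EquisingularLiftEquisingularLiftNatNDInvInit.lean`; imported.

-- (B4-round) `ndInv_round`: §13.12 below (DERIVED from (B4α′) `roundAtNDFrame` + (B4β′) `ndInvPersists` by the PROVED composition `ndInv_round_of`).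


end NDInvariant

/-! ## 13.12 (B4-round) SPLIT (desk R31/DEAL «ND-K5» (β): «idea-1 types the split as sorried sub-signatures with the composition PROVED»):
(B4α′) `RoundAtNDFrame` — THE TORIC HEART at one ND frame: after any blow-up of the closed point `x` carrying local ND frame data `(W, g)`, a strata tower from the
stepped frame boundary EXISTS, with regular top floor, closed strict-transform set, END (the reduced closure regular over `x`), ISO off `x`, and exact bookkeeping of
`T` off `x` (inside: (B4α) the standard tower over `𝔸ⁿ_k` along the won play of `g` — lead-2's ND dictionary `e1_along_play` / `not_bad_coordinateFace` /
`end_order_one_of_wonPlay` + companion §12.16 — and (B4β) its étale transport along the frame chart `t ↦ w`, `IsBlowup.of_isPullback_of_flat`, `StrictTransformBaseChange`);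
(B4β′) `NDInvPersists` — BOOKKEEPING: such a tower takes `NDInv (m+1)` to `NDInv m` (the other non-regular points and their ND frame data move along the isomorphism
off `x`; no new non-regular point over `x`).  `ndInv_round_of : RoundAtNDFrame → NDInvPersists → RoundFacts n k (NDInv n k)` is PROVED. -/

section RoundSplit

variable (n : ℕ) (k : Type) [Field k]

-- `RoundAtNDFrame`, `NDInvPersists`, `NDInvC`, `ndInvC_end`, `ndInv_round_of` are TREE DECLARATIONS since p639684 (`…NatNDInvariants.lean`); imported (v8).

/-! ### 13.13 (B4α′) SPLIT INTO (B4α) MODEL + (B4β) TRANSPORT (desk RULING 2026-08-28T14:08:16Z «RE-DEAL k-SIDE»: «idea-1 types (B4α) "standard toric tower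
over `𝔸ⁿ_k`" and (B4β) "étale transport along a frame chart" as two sorried signatures with `roundAtNDFrame_of : (B4α) → (B4β) → ND.RoundAtNDFrame n k` PROVED»;
owners (B4α) stub-4, (B4β) 027, backup stub-2).

THE MODEL.  `Aff n k = Spec k[X₁,…,Xₙ]` (`MvPolynomial (Fin n) k`), its origin `affOrigin` (the point `originIdeal k n = ker constantCoeff`, Literature
`…Resolution.OriginLocalRing`; closed: a maximal ideal), the COORDINATE FRAME `coordHyperplane i = 𝓘_{V(Xᵢ), red}` (reduced ideal sheaf of the closed set
`zeroLocus {Xᵢ}` — equal to `Xᵢ·𝒪` since `Xᵢ` is prime; cf. Literature `AffineCoordBlowup.𝓘Λ`/`ideal_𝓘Λ_top` for the same convention), the hypersurface SET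
`zeroLocus {g}`.  `ModelRound n k g` := the conclusion of `RoundAtNDFrame` VERBATIM at `(F₁, x, W, T₁) := (Aff n k, affOrigin, coordHyperplane, zeroLocus {g})`: after
ANY blow-up `π₀ : A₂ ⟶ 𝔸ⁿ` of the origin, a `StrataTower` from the stepped coordinate frame boundary with regular top floor, closed `T₉`, END over the origin, ISO
off it, exact bookkeeping off it.  (B4α) `modelRound [IsAlgClosed k] : LocalNDWon g → ModelRound n k g` — THE TORIC HEART, no `F₁`, no frame chart (`k = k̄` NEEDED: the tree's ND is over k-rational torus points, v8.1): follow the won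
play of `LocalNDWon g` MINUS ITS FIRST MOVE (for a CONVENIENT singular `g` the only `Bad` face of the orthant cone made of frame rays is the full cone — a proper
sub-face `τ ⊊ frame` is beaten by the pure power `X_j^{a_j}`, `j ∉ τ` — so EVERY legal play starts with the point star `𝟙 = Σ eⱼ` and every later star is at a face
with a non-frame ray, exactly `StrataTower.cons`'s `hτ`); each star = `IsBlowup` of the stratum (Literature `BlowupsExistence`), charts by
`AffineCoordBlowup.chartImm_comp`/`iSup_chart` (`…AffineCoordinateBlowupLocal`: «blow-up of a closed subset with an affine chart carrying it to `C_Λ`»), strict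
transform in a chart = `coordBlowupSubst`/`toricStrict` (lead-2's `…NatNDChartBlowup`), legality `hE1` from `Bad` (`bad_iff_toricStrict_vanishes`), `hT` because
`V(g) ∖ 0 ≠ ∅` is carried isomorphically, END from `Won` (`end_order_one_of_wonPlay`, `isSmoothCone_of_reach_orthant`), regular top = smooth toric blow-ups of `𝔸ⁿ`.
THE TRANSPORT.  `TransportRound n k` := `RoundAtNDFrame` with `IsNDFrameAt` UNPACKED (`w`, `g` universally quantified with their five relations) PLUS the hypothesis
`ModelRound n k g` for THAT `g`: port the model tower along the frame chart `Xⱼ ↦ wⱼ` (`k[X]_{(X)} → 𝒪_{F₁,x}` flat & unramified with `𝔪₀·𝒪 = 𝔪ₓ`; blow-ups and strict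
transforms commute with flat base change: `IsBlowup.of_isPullback_of_flat`, `StrictTransformBaseChange`; all centres lie over `x`, so each step of the tower on `F₂`
is the blow-up of a GLOBAL stratum of the stepped boundary whose support sits in the fibre over `x`; regularity / END / ISO descend).  COMPOSITION
`roundAtNDFrame_of_model : (∀ g, LocalNDWon g → ModelRound n k g) → TransportRound n k → RoundAtNDFrame n k` PROVED (pure logic); `roundAtNDFrame` is now DERIVED. -/

-- `Aff`, `affOrigin`, `isClosed_affOrigin`, `coordHyperplane`, `ModelRound`, `TransportRound`, `roundAtNDFrame_of_model` (§13.13 texts of record) are TREE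
-- DECLARATIONS since p641231 (`Theorems/…NatNDRoundModel.lean`, lead-2, = draft (3) 91f5ac84565ce08b VERBATIM); imported (v9 re-home).

/-! ### 13.14 (B4α) SUB-SPLIT (desk FORWARD DEAL 2026-08-28T14:24:05Z «ROUND 12 — type the (B4α) sub-split now»): the TORIC STAGE INVARIANT `ToricStage`, the
combinatorial DRIVER `PlayFacts` (B4α0), INIT (B4α1i) `ModelInit`, ONE TORIC STAR (B4α1s) `ModelStep`, END (B4α2) `ModelEnd`, and the PROVED composition
`modelRound_of_toricStage : PlayFacts n → (∀ g, LocalND g → ModelInit n k g) → (∀ g, LocalND g → ModelStep n k g) → (∀ g, LocalND g → ModelEnd n k g) →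
∀ g, LocalNDWon g → ModelRound n k g` (induction over the head-style play; each star realised by Literature `exists_isBlowup`).

THE INVARIANT `ToricStage n k g Φ F φ E T` («`(F, φ, E, T)` IS the smooth toric variety of the fan with maximal cones `Φ` over `𝔸ⁿ_k`, with its torus-invariant
boundary and the strict transform of `V(g)`», chart-wise): (TS0, v10) every cone of `Φ` is unimodular (`IsSmoothCone`; kills JUNK cones — without it `ModelStep` is
FALSE at `n = 1, g = X, Φ = {{e}, {(2),(−1)}}`: a move at the unused junk cone asks `hT : ¬ ∅ ⊆ ∅`; with it a Bad face with a non-frame ray forces `n ≥ 2`); (TS1) every point of `F` lies in a TORIC CHART `c : 𝔸ⁿ_k ⟶ F` (open immersion) attached to a cone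
`σ ∈ Φ` with unimodular natural chart matrix `B` (`σ = {rayOf (B i)}`, `det B = ±1`) such that `c ≫ φ = Spec (toricChartHom B)` (`t_l ↦ ∏_i y_i^{B i l}`, so
`chartPull B = toricChartHom B` on equations, `chartPull_eq_aeval`), the member of the ray `rayOf (B i)` pulls back to the coordinate hyperplane `V(y_i)`, the members
of rays outside `σ` pull back to `⊤` (no divisor), and `T` pulls back to the ZERO SET of the chart strict transform `toricStrict B g` (lead-2's `…NatNDChartPullback`);
(TS2) `φ` is an isomorphism off the origin, exact bookkeeping `T ∩ φ⁻¹(𝔸ⁿ ∖ 0) = φ⁻¹(V(g) ∖ 0)`, `T` closed, and every NON-FRAME member lies over the origin.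
WHY THESE CLAUSES: (TS1) is what ONE STAR transforms chart by chart (`AffineCoordBlowup.chartImm_comp` + `coordBlowupSubst_toricStrict`: the strict transform in the
new chart is `V(toricStrict (starChart B J i₀) g)` because `y_{i₀} ∤ toricStrict`, so no component hides in the exceptional hyperplane) and what END reads
(`exists_eval_pderiv_toricStrict_ne_zero`: order one at every point of the fibre ⇒ `T̂` regular there); (TS2) is what `ModelRound` asks off the origin and what makes
every later centre lie over the origin (`StrataTower.cons`'s `hτ`: a non-frame ray in every starred face).

THE DRIVER (B4α0) `PlayFacts n` (pure combinatorics of E1-legal plays from the orthant on a CONVENIENT nonempty table; suggested owner lead-2, home `…NatNDChartPlays`):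
from `Reach V (orthantFan n) Φ'` + `Won V Φ'` extract a HEAD-STYLE play `GoodPlay V (star (orthantFan n) frame) Φ''` to SOME won `Φ''` whose every move stars a
`Bad` face `τ ⊆ σ ∈ Φ` that (i) contains a NON-FRAME ray (convenience: `not_bad_coordinateFace`; after the first star no cone contains the whole frame) and (ii) is
FRESH: `Σ τ ∉ σ'` for every cone `σ' ⊉ τ` (else `stepAlong` would overwrite a live member — this is the fan property «cones meet along common faces»; suggested
proof: carry the SEPARATION INVARIANT «for `σ ≠ σ'` in `Φ` there is `ℓ ∈ ℤⁿ` with `ℓ ≥ 0` on `σ`, `ℓ ≤ 0` on `σ'`, `ℓ = 0` exactly on `σ ∩ σ'`», which stars preserve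
(new/new in one old cone: `ℓ = t'^* − t^*` in the dual basis; otherwise the old separator, and `ℓ(Σ τ) > 0` when `τ ⊄ σ'` IS freshness)); the FIRST move of any
won play with ≥ 1 move is the full-frame star (convenience), and a won orthant (`0 ∈ V`, or `n ≤ 1`) makes every position won (`GoodPlay.done`).
THE BRICKS: (B4α1i) `ModelInit` — ANY blow-up `π₀` of the origin is a toric stage at `star (orthantFan n) frame` (Literature `AffinePointBlowupCharts`: `chartImm`,
`iSup_chart`; `Aff (m+1) k = AffinePointBlowup.P m k`, `affOrigin (m+1) k = ξ m k` by `rfl`; `n = 0`: the blow-up of `Spec k` at its point is EMPTY); (B4α1s)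
`ModelStep` — ONE STAR: legality (`hE1` from `Bad` by `bad_iff_toricStrict_vanishes`, `hT` because `V(g) ∖ 0 ≠ ∅` for `n ≥ 2` over `k = k̄` — a Bad face with a
non-frame ray forces `n ≥ 2`) and the new toric stage after ANY blow-up of the stratum (Literature `AffineCoordinateBlowupCharts`/`…Local`, `BlowupsExistence`'s
`IsBlowup.isPullback_of_isOpenImmersion` to restrict the blow-up to a chart, `strictTransformIdeal` of principal monomial ideals); (B4α2) `ModelEnd` — at a WON fan the
stage is regular (`Hironaka2005.isRegular_Spec_mvPolynomial` + open cover) and `T̂` is regular at every point over the origin (`exists_eval_pderiv_toricStrict_ne_zero`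
with `I = {i : y_i = 0}`, fibre condition `∀ l, ∃ i ∈ I, 0 < B i l`; order one ⇒ `(G)_y` prime ⇒ `𝓘_{T̂,y} = (G)_y` ⇒ `𝒪_y/(G)` regular; non-closed points by
localisation).  Sizes (honest): (B4α0) M, (B4α1i) M, (B4α1s) L−, (B4α2) M. -/

-- §13.14 (B4α) SUB-SPLIT DECLARATIONS `toricChartHom`, `ToricStage`, `GoodPlay`, `PlayFacts`, `ModelInit`, `ModelStep`, `ModelEnd`, `strataTower_of_goodPlay`,
-- `modelRound_of_toricStage` are TREE DECLARATIONS since lead-2's port `Theorems/…NatNDRoundModelSplit.lean` (= port draft v4 2fd04eaad88dd372 VERBATIM); imported (v12).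
-- Their texts of record and clause-by-clause readings: port draft v4 / SPEC v11 (crux history f918bc7bf7cc).

-- `playFacts` is a TREE THEOREM since `Theorems/EquisingularLiftEquisingularLiftNatNDPlayFacts.lean`; imported.

-- `modelInit` is a TREE THEOREM since `Theorems/EquisingularLiftEquisingularLiftNatNDModelInit.lean`; imported.

-- `modelStep` is a TREE THEOREM since `Theorems/EquisingularLiftEquisingularLiftNatNDModelStep.lean`; imported.

-- `modelEnd` is a TREE THEOREM since `Theorems/EquisingularLiftEquisingularLiftNatNDModelRoundEnd.lean`; imported.

/-- **(B4α) DERIVED** (v9; was a `sorry` in v8/v8.1): from (B4α0) `playFacts`, (B4α1i) `modelInit`, (B4α1s) `modelStep`, (B4α2) `modelEnd` by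
`modelRound_of_toricStage`.  `[IsAlgClosed k]` (crit-3 OBJECTION 2026-08-28T14:21:05Z SUSTAINED 14:21:14Z — witness `n = 2, k = ℚ, g = (X₀²+2X₁²)² + X₀⁶ + X₁⁶`:
the tree's `IsLocallyNewtonNondegenerate` is over k-RATIONAL torus points).  Prover hint for the model: after `obtain ⟨m, rfl⟩ : ∃ m, n = m + 1`,
`Aff (m+1) k = AffinePointBlowup.P m k` and `affOrigin (m+1) k = AffinePointBlowup.ξ m k` hold by `rfl`.  [OURS · L1 W4.5b] -/
theorem modelRound [IsAlgClosed k] (g : MvPolynomial (Fin n) k) (hg : LocalNDWon g) : ModelRound n k g :=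
  modelRound_of_toricStage n k (playFacts n) (modelInit n k) (modelStep n k) (modelEnd n k) g hg

/-! **(B4β) `transportRound` — v8.1 SIGNATURE TEXT OF RECORD (was `sorry`; ÉTALE TRANSPORT along the frame chart, owner 027, backup stub-2; honest size M–L).**  Why it might fail: the residue
field `κ(x) ⊇ k` may be bigger than `k` when `F₁` is not of finite type — harmless (the frame chart `k[X]_{(X)} → 𝒪_{F₁,x}` is flat with `𝔪₀𝒪 = 𝔪ₓ` regardless, and the
toric tower is defined over the prime field), but the comparison of the CLOSED SET `T₉` with its model needs «closure commutes with the flat base change over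
`Spec 𝒪_{F₁,x}`» at the points over `x` — state and prove it for towers whose centres lie over `x`.  [OURS · L1 W4.5b] -/
-- (v10) `transportRound` is DERIVED below (§13.15) from (B4β0)/(B4β1)/(B4β2) + the model bricks.

/-! ### 13.15 (B4β) SUB-SPLIT (desk RULING 2026-08-28T14:29:10Z (3): «(B4β1) one `StrataTower` step base-changes along a flat morphism of bases with compatible
boundaries / (B4β2) regular top, END and ISO-off-`x` ascend along the flat local map `k[t]_{(t)} → 𝒪_{F₁,x}`; `transportRound_of` PROVED»).  MY SEAM: the transport
never touches the model's opaque `∃`-tower; it REPLAYS THE GOOD PLAY on both sides at once, carrying (i) the model stage invariant `ToricStage` (§13.14), (ii) a light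
F-SIDE invariant `FStage` (iso off `x`, bookkeeping off `x`, `T` closed, non-frame members over `x` — all F-side-only facts) and (iii) the LINK `Linked`: over the local
base `S := Spec 𝒪_{F₁,x}` — mapped to `F₁` by `F₁.fromSpecStalk x` and to `𝔸ⁿ_k` by `frameBaseMap` (`t_j ↦ w_j` over `baseToStalk`) — ONE scheme `L` that is
SIMULTANEOUSLY the pullback of the F-stage and of the model stage, with equal pulled-back boundaries and `T`'s («the F-side stage localised at `x` IS the flat base
change of the model stage»; no explicit isomorphism is named: `L` carries both `IsPullback` squares).  Bricks: (B4β0) `TransportInit` — the two point blow-ups are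
linked (both flat base changes are THE blow-up of `S` at its closed point: `IsBlowup.pullback_snd_of_flat`/`of_isPullback_of_flat` + uniqueness of blow-ups; `fromSpecStalk`
is flat (localisation); `frameBaseMap` is flat — local homomorphism of regular local rings of equal dimension `n` with `𝔪₀𝒪 = 𝔪_x` (`h2`, `h3`, `hreg`); frame members:
`(W j)|_S = (w_j) = (X_j)|_S` by `h1`; `T`: `𝓘_{T₁,x} = (g(w))` is `h5`, closures commute with FLAT preimages by going-down) and the first F-stage holds; (B4β1)
`TransportStep` — ONE LINKED STEP: F-side legality (`hE1` through `L` from the model's `hE1`; `hT` F-side: a starred face with a non-frame ray in a unimodular cone forces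
`n ≥ 2` (TS0), so `x` is NOT isolated in `T₁` (`h5`: `(g(w)) ≠ 𝔪_x`), and the iso off `x` puts a point of `T` off the centre), the new F-stage, and the new link
(blow-ups of the SAME ideal on `L` — boundary compat + `comap` of a finset sup — base-changed flatly from both sides; stepped boundaries by `StrictTransformBaseChange`;
closures by going-down) — this is the desk's (B4β1) infrastructure lemma, per step; (B4β2) `TransportEnd` — ASCENT at the end: `F₉` is regular off `x` (iso to `F₁ ∖ x`)
and at points over `x` through `L` (`𝒪_{F₉,y} = 𝒪_{L,y'}`, pro-open immersion; `𝒪_{A₉,b y'} → 𝒪_{L,y'}` flat local with closed fibre a localisation of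
`κ(x) ⊗_k κ(b y')`, regular as `k` is perfect — or Cohen `𝒪̂_{F₁,x} ≅ κ(x)⟦w⟧`, crit-3 R-T1), END likewise for `T̂₉` (radicals commute with this base change: geometrically
reduced fibres).  COMPOSITION `transportRound_of_toricStage : PlayFacts n → (∀ g, LocalND g → ModelInit/ModelStep/ModelEnd n k g) → TransportInit n k →
TransportStep n k → TransportEnd n k → TransportRound n k` PROVED below (joint induction `linkedTower_of_goodPlay`; the hypothesis `ModelRound n k g` of `TransportRound`
is not even used — the finer model bricks replace it).  Sizes (honest): (B4β0) M, (B4β1) L−, (B4β2) M+.  Hands (desk (4)): (B4β0)+(B4β1) stub-2, (B4β2) 027 / lead-1. -/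

-- §13.13′ LN CHAIN `NDInvCLN`, `ndInvCLN_end`, `RoundAtNDFrameLN`, `TransportRoundLN`, `roundAtNDFrameLN_of_model`, `ndInvLN_round_of` are TREE DECLARATIONS since the
-- same port; imported (v12).

/-! ## 13.15 (B4β) SUB-SPLIT — the LINKED replay of the good play (v11: every F-stage locally Noetherian) -/

-- §13.15 (B4β) SUB-SPLIT DECLARATIONS `frameBaseMap`, `Linked`, `FStage`, `TransportInit`, `TransportStep`, `TransportEnd`, `linkedTower_of_goodPlay`,
-- `transportRoundLN_of_toricStage` are TREE DECLARATIONS since the same port; imported (v12).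

-- `transportInit` is a TREE THEOREM since `Theorems/EquisingularLiftEquisingularLiftNatNDTransportInit.lean`; imported.

-- `transportStep` is a TREE THEOREM since `Theorems/EquisingularLiftEquisingularLiftNatNDTransportStep.lean`; imported.

-- `transportEnd` is a TREE THEOREM since `Theorems/EquisingularLiftEquisingularLiftNatNDTransportEnd.lean`; imported.

/-- **(B4β-LN) DERIVED** (v11): the LN transport round from the model bricks (B4α0)/(B4α1i)/(B4α1s)/(B4α2) and the transport bricks (B4β0)/(B4β1)/(B4β2) by
`transportRoundLN_of_toricStage`.  [OURS · L1 W4.5b] -/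
theorem transportRoundLN [IsAlgClosed k] : TransportRoundLN n k :=
  transportRoundLN_of_toricStage n k (playFacts n) (modelInit n k) (modelStep n k) (modelEnd n k) (transportInit n k) (transportStep n k) (transportEnd n k)

/-- **(B4α′-LN) DERIVED** from (B4α) `modelRound` and (B4β-LN) `transportRoundLN`. [OURS · L1 W4.5b] -/
theorem roundAtNDFrameLN [IsAlgClosed k] : RoundAtNDFrameLN n k :=
  roundAtNDFrameLN_of_model n k (modelRound n k) (transportRoundLN n k)

-- (B4β′) `ndInvPersists (n) (k) [Field k] : NDInvPersists n k` IS A TREE THEOREM (lead-2, p640760 ✓ `Theorems/…NatNDInvPersists.lean` 3422dea0789d3b43) — used BY NAME below (v9).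

/-- **(B4-round-LN) DERIVED** (for the closed LN variant `NDInvCLN`). [OURS · L1 W4.5b] -/
theorem ndInvLN_round [IsAlgClosed k] : RoundFacts n k (NDInvCLN n k) :=
  ndInvLN_round_of n k (roundAtNDFrameLN n k) (ndInvPersists n k)

end RoundSplit

/-! ## 13.11 (B4) `hres_toricRounds` — DERIVED from the LN invariant `NDInvCLN` (v11) by the tree's `hres_of_rounds` -/

/-- **(B4) `hres_toricRounds` — K5′'s `hres` BLOCK at `Reach := ReachToric n`, under `nd_rung_local`'s hypotheses; DERIVED (v4) from (B4-init) `ndInv_init`,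
(B4-end) `ndInv_end` (proved), (B4-round) `ndInv_round` through the PROVED k-side iteration `hres_of_rounds`.**  [OURS · L1 W4.5b] -/
theorem hres_toricRounds (n : ℕ) (p : ℕ) (hp : p.Prime) (k : Type) [Field k] [CharP k p] [IsAlgClosed k]
    (H : AlgebraicGeometry.Scheme.{0}) (ι : H ⟶ (Literature.AlgebraicGeometry.Motives.projectiveSpace n k).left)
    (hι : AlgebraicGeometry.IsClosedImmersion ι) (hH : AlgebraicGeometry.IsIntegral H)
    (hloc : ∀ y : (Literature.AlgebraicGeometry.Motives.projectiveSpace n k).left,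
      ∃ U : (Literature.AlgebraicGeometry.Motives.projectiveSpace n k).left.affineOpens,
        y ∈ (U : (Literature.AlgebraicGeometry.Motives.projectiveSpace n k).left.Opens) ∧ (ι.ker.ideal U).IsPrincipal)
    (hfin : Set.Finite {x : H | ¬ IsRegularLocalRing (H.presheaf.stalk x)})
    (hND : IsoHypNDWon k n H ι) :
    (∃ (F' : AlgebraicGeometry.Scheme.{0}) (ρ' : F' ⟶ (Literature.AlgebraicGeometry.Motives.projectiveSpace n k).left)
        (T' : Set F'),
      (∀ Q : (∀ F₁ : AlgebraicGeometry.Scheme.{0}, (F₁ ⟶ (Literature.AlgebraicGeometry.Motives.projectiveSpace n k).left) →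
          Set F₁ → Prop),
        Q (Literature.AlgebraicGeometry.Motives.projectiveSpace n k).left
          (𝟙 (Literature.AlgebraicGeometry.Motives.projectiveSpace n k).left) (Set.range ι) →
        (∀ (F₁ F₂ : AlgebraicGeometry.Scheme.{0}) (ρ : F₁ ⟶ (Literature.AlgebraicGeometry.Motives.projectiveSpace n k).left)
            (T₁ : Set F₁)
            (x : ↥(AlgebraicGeometry.Scheme.IdealSheafData.vanishingIdeal
              (⟨closure T₁, isClosed_closure⟩ : TopologicalSpace.Closeds F₁)).subscheme)
            (υ : F₂ ⟶ F₁)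
            (hx : IsClosed ({((AlgebraicGeometry.Scheme.IdealSheafData.vanishingIdeal
              (⟨closure T₁, isClosed_closure⟩ : TopologicalSpace.Closeds F₁)).subschemeι x : F₁)} : Set F₁)),
          Q F₁ ρ T₁ →
          ¬ IsRegularLocalRing ((AlgebraicGeometry.Scheme.IdealSheafData.vanishingIdeal
              (⟨closure T₁, isClosed_closure⟩ : TopologicalSpace.Closeds F₁)).subscheme.presheaf.stalk x) →
          IsRegularLocalRing (F₁.presheaf.stalk ((AlgebraicGeometry.Scheme.IdealSheafData.vanishingIdeal
              (⟨closure T₁, isClosed_closure⟩ : TopologicalSpace.Closeds F₁)).subschemeι x)) →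
          Literature.AlgebraicGeometry.Resolution.IsBlowup υ
            (AlgebraicGeometry.Scheme.IdealSheafData.vanishingIdeal
              (⟨{((AlgebraicGeometry.Scheme.IdealSheafData.vanishingIdeal
                (⟨closure T₁, isClosed_closure⟩ : TopologicalSpace.Closeds F₁)).subschemeι x : F₁)}, hx⟩ :
                TopologicalSpace.Closeds F₁)) →
          Q F₂ (υ ≫ ρ) (closure (υ ⁻¹' (T₁ \ {((AlgebraicGeometry.Scheme.IdealSheafData.vanishingIdeal
              (⟨closure T₁, isClosed_closure⟩ : TopologicalSpace.Closeds F₁)).subschemeι x : F₁)}))) ∧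
          (∀ (F₉ : AlgebraicGeometry.Scheme.{0}) (β : F₉ ⟶ F₂) (T₉ : Set F₉),
            ReachToric n F₁ F₂ υ ((AlgebraicGeometry.Scheme.IdealSheafData.vanishingIdeal
                (⟨closure T₁, isClosed_closure⟩ : TopologicalSpace.Closeds F₁)).subschemeι x)
              (closure (υ ⁻¹' (T₁ \ {((AlgebraicGeometry.Scheme.IdealSheafData.vanishingIdeal
                (⟨closure T₁, isClosed_closure⟩ : TopologicalSpace.Closeds F₁)).subschemeι x : F₁)}))) F₉ β T₉ →
            Q F₉ ((β ≫ υ) ≫ ρ) T₉)) →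
        Q F' ρ' T') ∧
      Literature.AlgebraicGeometry.Resolution.Scheme.IsRegular (AlgebraicGeometry.Scheme.IdealSheafData.vanishingIdeal
        (⟨closure T', isClosed_closure⟩ : TopologicalSpace.Closeds F')).subscheme) :=
  by
    obtain ⟨m, hm⟩ := ndInv_init n p hp k H ι hι hH hloc hfin hND
    haveI := hι
    have hLNP : IsLocallyNoetherian (Literature.AlgebraicGeometry.Motives.projectiveSpace n k).left :=
      AlgebraicGeometry.LocallyOfFiniteType.isLocallyNoetherian (Literature.AlgebraicGeometry.Motives.projectiveSpace n k).hom
    exact hres_of_rounds n k H ι (NDInvCLN n k) ⟨m, ⟨hm, ι.isClosedEmbedding.isClosed_range⟩, hLNP⟩ (ndInvCLN_end n k) (ndInvLN_round n k)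

/-! ## 13.8 THE RUNG through K5′ (moved after §13.11 in v4) -/

/-- **`nd_rung_local_K5`** — the type of NNR §10.3 `nd_rung_local` VERBATIM (every `n`), PROVED from (B3) `hsub_strataLift` and (B4) `hres_toricRounds` by the
tree's K5′ `target_elnat_of_subchainResolution'` at `Reach := ReachToric n`.  [OURS · L1 W4.5b · pure logic over K5′] -/
theorem nd_rung_local_K5 (n : ℕ) (p : ℕ) (hp : p.Prime) (k : Type) [Field k] [CharP k p] [IsAlgClosed k]
    (H : AlgebraicGeometry.Scheme.{0}) (ι : H ⟶ (Literature.AlgebraicGeometry.Motives.projectiveSpace n k).left)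
    (hι : AlgebraicGeometry.IsClosedImmersion ι) (hH : AlgebraicGeometry.IsIntegral H)
    (hloc : ∀ y : (Literature.AlgebraicGeometry.Motives.projectiveSpace n k).left,
      ∃ U : (Literature.AlgebraicGeometry.Motives.projectiveSpace n k).left.affineOpens,
        y ∈ (U : (Literature.AlgebraicGeometry.Motives.projectiveSpace n k).left.Opens) ∧ (ι.ker.ideal U).IsPrincipal)
    (hfin : Set.Finite {x : H | ¬ IsRegularLocalRing (H.presheaf.stalk x)})
    (hND : IsoHypNDWon k n H ι) : ELNatConclusionO k n H ι :=
  target_elnat_of_subchainResolution' p hp k n H ι hι hH hloc (ReachToric n) (hsub_strataLift k n)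
    (hres_toricRounds n p hp k H ι hι hH hloc hfin hND)

/-- The TYPE of the registered 4th child `stub_elnat_three_isolated_newtonNondegenerate` (character-identical to NNR §10.3 `NDStubWon`).  [OURS · abbreviation] -/
def NDStubWonK5 : Prop :=
  ∀ p : ℕ, p.Prime → ∀ (k : Type) [Field k] [CharP k p] [IsAlgClosed k] (n : ℕ) (H : AlgebraicGeometry.Scheme.{0})
    (ι : H ⟶ (Literature.AlgebraicGeometry.Motives.projectiveSpace n k).left),
    AlgebraicGeometry.IsClosedImmersion ι → AlgebraicGeometry.IsIntegral H →
    (∀ y : (Literature.AlgebraicGeometry.Motives.projectiveSpace n k).left,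
      ∃ U : (Literature.AlgebraicGeometry.Motives.projectiveSpace n k).left.affineOpens,
        y ∈ (U : (Literature.AlgebraicGeometry.Motives.projectiveSpace n k).left.Opens) ∧ (ι.ker.ideal U).IsPrincipal) →
    n = 3 → ¬ Literature.AlgebraicGeometry.Resolution.Scheme.IsRegular H →
    Set.Finite {x : H | ¬ IsRegularLocalRing (H.presheaf.stalk x)} →
    IsoHypNDWon k n H ι → ELNatConclusionO k n H ι

/-- The registered 4th child closes BY NAME from (B3)+(B4): `exact ndStubWonK5_holds p hp k n H ι …`.  [OURS · pure logic] -/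
theorem ndStubWonK5_holds : NDStubWonK5 := by
  intro p hp k _ _ _ n H ι hι hH hloc _ _ hfin hND
  exact nd_rung_local_K5 n p hp k H ι hι hH hloc hfin hND

end Summit.ResolutionOfSingularities.ResolutionOfSingularities.Cruxes.EquisingularLiftNat.Sections.ND

end
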